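import Mathlib.NumberTheory.ModularForms.QExpansion
import HarnessLib

/-!
# CKMRV interpolation, step 7: expansions of functions on `ℍ` annihilated by `(T − I)²`

Support file for the proof of the Cohn–Kumar–Miller–Radchenko–Viazovska interpolation theorem
(`Literature/Analysis/Fourier/RadialSchwartzInterpolation.lean`, named fact
`CKMRV2022_interpolationFormula` = Ann. Math. 196 (2022), Theorem 1.7). This is the complex-analytic
core of the **first half of CKMRV Theorem 3.1** (proof, first part: "We begin by obtaining the
expansion of `F` …"), for a single holomorphic function `F : ℍ → ℂ` (the `x`-dependence is added
in a later step):

Suppose `F` is holomorphic on `ℍ`, satisfies `F(τ+2) − 2F(τ+1) + F(τ) = 0`, and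
`|F(τ)| ≤ α Im(τ)^{−β}` (`β > 0`) on the strip `|Re τ| ≤ 1`. Put `G(τ) = F(τ+1) − F(τ)`
(`shiftDiff F`) and `H(τ) = F(τ) − τ G(τ)` (`shiftRem F`). Then (all proved here)

* `G` and `H` are `1`-periodic and holomorphic (`periodic_shiftDiff`, `periodic_shiftRem`, …);
* `G → 0` at `i∞`, hence (Mathlib's `exp_decay_atImInfty`) `G = O(e^{−2π Im τ})`, hence also
  `H → 0` at `i∞` ("the parenthetical expression decays exponentially as `Im(τ) → ∞` by (3.4)");
* so both have `q`-expansions without constant term (Mathlib's `UpperHalfPlane.hasSum_qExpansion`):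
  `G(τ) = ∑_{n≥1} gₙ qⁿ`, `H(τ) = ∑_{n≥1} aₙ qⁿ`, `q = e^{2πiτ}`, and therefore
  **`F(τ) = ∑_{n≥1} aₙ qⁿ + τ ∑_{n≥1} gₙ qⁿ`** (`hasSum_shiftRem`, `hasSum_shiftDiff`,
  `eq_tsum_add_mul_tsum`) — CKMRV (3.3)–(3.5) with `2πi√(2n) bₙ = gₙ`;
* the coefficients are given by the integrals (3.6)–(3.7) over horizontal segments (Mathlib's
  `qExpansion_coeff_eq_intervalIntegral`) and are bounded by `e^{2πnt} sup_{u∈[0,1]} |·(u+it)|`,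
  whence, with `t = 1/n`, **polynomial growth in `n`** (`norm_qExpansion_coeff_le_of_strip`).

Everything is proved; no named facts.

## References

* H. Cohn, A. Kumar, S. D. Miller, D. Radchenko, M. Viazovska, *Universal optimality of the `E₈`
  and Leech lattices and interpolation formulas*, Ann. of Math. 196 (2022), §3.1, Theorem 3.1,
  first part of the proof (eqs. (3.3)–(3.7)). [CohnEtAl2019]
-/

noncomputable section

open scoped Topology UpperHalfPlane Manifold Real
open Filter Complex UpperHalfPlane Function

namespace Literature.Analysis.Fourier

/-! ## The first and second periodic pieces `G = F(·+1) − F`, `H = F − τ G` -/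

/-- `G(τ) = F(τ + 1) − F(τ)` (CKMRV, proof of Theorem 3.1: "The difference `F(τ+1,x) − F(τ,x)` is
holomorphic in `τ` and invariant under `τ ↦ τ + 1`"). [cite: CohnEtAl2019, §3.1 (proof of Theorem 3.1)] -/
def shiftDiff (F : ℍ → ℂ) (τ : ℍ) : ℂ := F ((1 : ℝ) +ᵥ τ) - F τ

/-- `H(τ) = F(τ) − τ (F(τ+1) − F(τ))` (CKMRV: "To obtain `aₙ(x)`, we instead look at
`F(τ,x) − τ(F(τ+1,x) − F(τ,x))`, which is again holomorphic in `τ` and invariant under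
`τ ↦ τ + 1`"). [cite: CohnEtAl2019, §3.1 (proof of Theorem 3.1)] -/
def shiftRem (F : ℍ → ℂ) (τ : ℍ) : ℂ := F τ - (τ : ℂ) * shiftDiff F τ

variable {F : ℍ → ℂ}

/-- `F = H + τ G`. [folklore] -/
theorem eq_shiftRem_add (F : ℍ → ℂ) (τ : ℍ) : F τ = shiftRem F τ + (τ : ℂ) * shiftDiff F τ := by
  simp [shiftRem]

/-- `(1 +ᵥ (1 +ᵥ τ)) = 2 +ᵥ τ`. [folklore] -/
theorem one_vadd_one_vadd (τ : ℍ) : ((1 : ℝ) +ᵥ ((1 : ℝ) +ᵥ τ) : ℍ) = (2 : ℝ) +ᵥ τ := by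
  rw [vadd_vadd]; norm_num

/-- Under `F(τ+2) − 2F(τ+1) + F(τ) = 0`, `G(τ + 1) = G(τ)`. [cite: CohnEtAl2019, §3.1 (proof of Theorem 3.1)] -/
theorem shiftDiff_one_vadd (hFE : ∀ τ : ℍ, F ((2 : ℝ) +ᵥ τ) - 2 * F ((1 : ℝ) +ᵥ τ) + F τ = 0)
    (τ : ℍ) : shiftDiff F ((1 : ℝ) +ᵥ τ) = shiftDiff F τ := by
  simp only [shiftDiff, one_vadd_one_vadd]
  linear_combination hFE τ

/-- Under `F(τ+2) − 2F(τ+1) + F(τ) = 0`, `H(τ + 1) = H(τ)`. [cite: CohnEtAl2019, §3.1 (proof of Theorem 3.1)] -/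
theorem shiftRem_one_vadd (hFE : ∀ τ : ℍ, F ((2 : ℝ) +ᵥ τ) - 2 * F ((1 : ℝ) +ᵥ τ) + F τ = 0)
    (τ : ℍ) : shiftRem F ((1 : ℝ) +ᵥ τ) = shiftRem F τ := by
  have h := shiftDiff_one_vadd hFE τ
  simp only [shiftRem, h, coe_vadd]
  simp only [shiftDiff] at h ⊢
  push_cast
  ring

/-- `ofComplex (z + 1) = 1 +ᵥ ofComplex z` for `Im z > 0`. [folklore] -/
theorem ofComplex_add_one {z : ℂ} (hz : 0 < z.im) :
    ofComplex (z + 1) = (1 : ℝ) +ᵥ ofComplex z := by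
  have hz1 : 0 < (z + 1).im := by simpa using hz
  rw [ofComplex_apply_of_im_pos hz1, ofComplex_apply_of_im_pos hz]
  ext1
  simp [coe_vadd, add_comm]

/-- A function `ℍ → ℂ` with `f(τ+1) = f(τ)` is `1`-periodic after composing with `ofComplex`
(for `Im z ≤ 0` both sides are the same junk value). [folklore] -/
theorem periodic_comp_ofComplex_of_one_vadd {f : ℍ → ℂ} (hf : ∀ τ : ℍ, f ((1 : ℝ) +ᵥ τ) = f τ) :
    Periodic (f ∘ ofComplex) 1 := by
  intro z
  simp only [Function.comp_apply]
  rcases lt_or_ge 0 z.im with hz | hz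
  · rw [ofComplex_add_one hz, hf]
  · rw [ofComplex_apply_eq_of_im_nonpos (by simpa using hz) hz]

/-- `G` is `1`-periodic. [cite: CohnEtAl2019, §3.1 (proof of Theorem 3.1)] -/
theorem periodic_shiftDiff (hFE : ∀ τ : ℍ, F ((2 : ℝ) +ᵥ τ) - 2 * F ((1 : ℝ) +ᵥ τ) + F τ = 0) :
    Periodic (shiftDiff F ∘ ofComplex) 1 :=
  periodic_comp_ofComplex_of_one_vadd (shiftDiff_one_vadd hFE)

/-- `H` is `1`-periodic. [cite: CohnEtAl2019, §3.1 (proof of Theorem 3.1)] -/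
theorem periodic_shiftRem (hFE : ∀ τ : ℍ, F ((2 : ℝ) +ᵥ τ) - 2 * F ((1 : ℝ) +ᵥ τ) + F τ = 0) :
    Periodic (shiftRem F ∘ ofComplex) 1 :=
  periodic_comp_ofComplex_of_one_vadd (shiftRem_one_vadd hFE)

/-! ## Holomorphy -/

/-- `τ ↦ f(τ + 1)` is holomorphic if `f` is. [folklore] -/
theorem mdifferentiable_one_vadd {f : ℍ → ℂ} (hf : MDiff f) : MDiff fun τ : ℍ => f ((1 : ℝ) +ᵥ τ) := by
  intro τ
  rw [mdifferentiableAt_iff]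
  have h1 : DifferentiableAt ℂ (f ∘ ofComplex) ((τ : ℂ) + 1) := by
    have := mdifferentiableAt_iff.1 (hf ((1 : ℝ) +ᵥ τ))
    rwa [coe_vadd, ofReal_one, add_comm] at this
  have hadd : DifferentiableAt ℂ (fun z : ℂ => z + 1) (τ : ℂ) := differentiableAt_id.add_const 1
  have h2 : DifferentiableAt ℂ ((f ∘ ofComplex) ∘ fun z : ℂ => z + 1) (τ : ℂ) :=
    DifferentiableAt.comp (τ : ℂ) h1 hadd
  refine h2.congr_of_eventuallyEq ?_
  filter_upwards [isOpen_upperHalfPlaneSet.mem_nhds τ.im_pos] with z hz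
  simp only [Function.comp_apply, ofComplex_add_one (show 0 < z.im from hz)]

/-- `G` is holomorphic. [folklore] -/
theorem mdifferentiable_shiftDiff (hf : MDiff F) : MDiff (shiftDiff F) :=
  (mdifferentiable_one_vadd hf).sub hf

/-- `H` is holomorphic. [folklore] -/
theorem mdifferentiable_shiftRem (hf : MDiff F) : MDiff (shiftRem F) :=
  hf.sub (mdifferentiable_coe.mul (mdifferentiable_shiftDiff hf))

/-! ## Behaviour at `i∞` -/

/-- Translating by an integer does not change a function that is `1`-periodic after `ofComplex`:
reduction of `τ` to the strip `−1 ≤ Re τ < 0` with the same imaginary part. [folklore] -/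
theorem exists_re_mem_Ico_of_periodic {f : ℍ → ℂ} (hf : Periodic (f ∘ ofComplex) 1) (τ : ℍ) :
    ∃ τ' : ℍ, τ'.im = τ.im ∧ τ'.re ∈ Set.Ico (-1 : ℝ) 0 ∧ f τ' = f τ := by
  set n : ℤ := ⌊τ.re⌋ + 1 with hn
  refine ⟨(-(n : ℝ)) +ᵥ τ, by simp [vadd_im], ?_, ?_⟩
  · simp only [vadd_re, Set.mem_Ico, hn]
    push_cast
    constructor <;> linarith [Int.floor_le τ.re, Int.lt_floor_add_one τ.re]
  · have h := hf.sub_int_mul_eq n (x := (τ : ℂ))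
    simp only [Function.comp_apply, mul_one, ofComplex_apply] at h
    rw [← h]
    congr 1
    have him : 0 < ((τ : ℂ) - n).im := by simp [τ.im_pos]
    rw [ofComplex_apply_of_im_pos him]
    ext1
    simp [coe_vadd]
    ring

/-- **`G → 0` at `i∞`:** from `|F| ≤ α Im(τ)^{−β}` on `|Re τ| ≤ 1` (`β > 0`) and the periodicity of
`G`. [cite: CohnEtAl2019, §3.1 (proof of Theorem 3.1)] -/
theorem isZeroAtImInfty_shiftDiff (hFE : ∀ τ : ℍ, F ((2 : ℝ) +ᵥ τ) - 2 * F ((1 : ℝ) +ᵥ τ) + F τ = 0)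
    {α β : ℝ} (hβ : 0 < β) (hstrip : ∀ τ : ℍ, |τ.re| ≤ 1 → ‖F τ‖ ≤ α * τ.im ^ (-β)) :
    IsZeroAtImInfty (shiftDiff F) := by
  -- the bound `‖G τ‖ ≤ 2 α Im(τ)^{-β}` for all `τ`
  have hG : ∀ τ : ℍ, ‖shiftDiff F τ‖ ≤ 2 * α * τ.im ^ (-β) := by
    intro τ
    obtain ⟨τ', him, hre, heq⟩ := exists_re_mem_Ico_of_periodic (periodic_shiftDiff hFE) τ
    rw [← heq, ← him]
    have h1 : |τ'.re| ≤ 1 := abs_le.2 ⟨hre.1, by linarith [hre.2]⟩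
    have h2 : |((1 : ℝ) +ᵥ τ').re| ≤ 1 := by
      rw [vadd_re]; exact abs_le.2 ⟨by linarith [hre.1], by linarith [hre.2]⟩
    calc ‖shiftDiff F τ'‖ ≤ ‖F ((1 : ℝ) +ᵥ τ')‖ + ‖F τ'‖ := norm_sub_le _ _
      _ ≤ α * ((1 : ℝ) +ᵥ τ').im ^ (-β) + α * τ'.im ^ (-β) := add_le_add (hstrip _ h2) (hstrip _ h1)
      _ = 2 * α * τ'.im ^ (-β) := by rw [vadd_im]; ring
  have hα : 0 ≤ α := by
    have h := hG UpperHalfPlane.I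
    have : (0 : ℝ) < UpperHalfPlane.I.im ^ (-β) := Real.rpow_pos_of_pos (by simp) _
    nlinarith [norm_nonneg (shiftDiff F UpperHalfPlane.I)]
  rw [IsZeroAtImInfty, ZeroAtFilter]
  rw [Metric.tendsto_nhds]
  intro ε hε
  -- choose `A ≥ 1` with `2 α A^{-β} < ε`
  obtain ⟨A, hA1, hA⟩ : ∃ A : ℝ, 1 ≤ A ∧ 2 * α * A ^ (-β) < ε := by
    have ht : Tendsto (fun A : ℝ => 2 * α * A ^ (-β)) atTop (𝓝 (2 * α * 0)) :=
      (tendsto_rpow_neg_atTop hβ).const_mul _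
    rw [mul_zero] at ht
    obtain ⟨A, hA⟩ := ((ht.eventually (gt_mem_nhds hε)).and (eventually_ge_atTop 1)).exists
    exact ⟨A, hA.2, hA.1⟩
  rw [Filter.Eventually, atImInfty_mem]
  refine ⟨A, fun τ hτ => ?_⟩
  simp only [Set.mem_setOf_eq, dist_zero_right]
  have hApos : 0 < A := by linarith
  calc ‖shiftDiff F τ‖ ≤ 2 * α * τ.im ^ (-β) := hG τ
    _ ≤ 2 * α * A ^ (-β) := by
        refine mul_le_mul_of_nonneg_left ?_ (by positivity)
        exact Real.rpow_le_rpow_of_nonpos hApos hτ (by linarith)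
    _ < ε := hA

/-- `(1 + y) e^{−2πy} ≤ 1/y` for `y ≥ 1` (crude). [folklore] -/
theorem one_add_mul_exp_neg_two_pi_le {y : ℝ} (hy : 1 ≤ y) : (1 + y) * Real.exp (-2 * π * y) ≤ 1 / y := by
  have hpy : 0 < 2 * π * y := by positivity
  have h1 : (2 * π * y) ^ 2 / 2 ≤ Real.exp (2 * π * y) := by
    have := Real.pow_div_factorial_le_exp (2 * π * y) hpy.le 2
    simpa using this
  rw [show -2 * π * y = -(2 * π * y) by ring, Real.exp_neg, ← div_eq_mul_inv,
    div_le_div_iff₀ (Real.exp_pos _) (by linarith), one_mul]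
  have hπ : (2 : ℝ) ≤ π := Real.two_le_pi
  have hπ2 : (4 : ℝ) ≤ π ^ 2 := by nlinarith
  have hy0 : 0 ≤ y := by linarith
  have h2 : (1 + y) * y ≤ (2 * π * y) ^ 2 / 2 :=
    calc (1 + y) * y ≤ 8 * y ^ 2 := by nlinarith
      _ ≤ 2 * π ^ 2 * y ^ 2 := by nlinarith [mul_nonneg (sub_nonneg.2 hπ2) (sq_nonneg y)]
      _ = (2 * π * y) ^ 2 / 2 := by ring
  linarith

/-- **`H → 0` at `i∞`:** `|H| ≤ |F| + |τ||G|` on the strip `−1 ≤ Re τ ≤ 0`, where `G` decays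
exponentially (Mathlib's `exp_decay_atImInfty`), and `H` is `1`-periodic.
[cite: CohnEtAl2019, §3.1 (proof of Theorem 3.1)] -/
theorem isZeroAtImInfty_shiftRem (hF : MDiff F)
    (hFE : ∀ τ : ℍ, F ((2 : ℝ) +ᵥ τ) - 2 * F ((1 : ℝ) +ᵥ τ) + F τ = 0)
    {α β : ℝ} (hβ : 0 < β) (hstrip : ∀ τ : ℍ, |τ.re| ≤ 1 → ‖F τ‖ ≤ α * τ.im ^ (-β)) :
    IsZeroAtImInfty (shiftRem F) := by
  have hG0 := isZeroAtImInfty_shiftDiff hFE hβ hstrip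
  have hGdec := hG0.exp_decay_atImInfty one_pos (periodic_shiftDiff hFE)
    (mdifferentiable_shiftDiff hF) hG0.isBoundedAtImInfty
  obtain ⟨C, hC⟩ := hGdec.bound
  rw [Filter.Eventually, atImInfty_mem] at hC
  obtain ⟨A₀, hA₀⟩ := hC
  have hα : 0 ≤ α := by
    have h := hstrip UpperHalfPlane.I (by simp)
    have : (0 : ℝ) < UpperHalfPlane.I.im ^ (-β) := Real.rpow_pos_of_pos (by simp) _
    nlinarith [norm_nonneg (F UpperHalfPlane.I)]
  have hC0 : 0 ≤ C := by
    set τ₀ : ℍ := UpperHalfPlane.mk ((max A₀ 1 : ℝ) * Complex.I) (by simp) with hτ₀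
    have him : τ₀.im = max A₀ 1 := by simp [hτ₀, UpperHalfPlane.im]
    have h := hA₀ τ₀ (by rw [him]; exact le_max_left _ _)
    simp only [Set.mem_setOf_eq, div_one, Real.norm_eq_abs, abs_of_pos (Real.exp_pos _)] at h
    nlinarith [norm_nonneg (shiftDiff F τ₀), Real.exp_pos (-2 * π * τ₀.im)]
  -- the bound `‖H τ‖ ≤ α Im^{-β} + C/Im` for `Im τ ≥ max A₀ 1`, all `τ`
  have hH : ∀ τ : ℍ, max A₀ 1 ≤ τ.im → ‖shiftRem F τ‖ ≤ α * τ.im ^ (-β) + C * (1 / τ.im) := by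
    intro τ hτ
    obtain ⟨τ', him, hre, heq⟩ := exists_re_mem_Ico_of_periodic (periodic_shiftRem hFE) τ
    rw [← heq, ← him]
    rw [← him] at hτ
    have h1 : |τ'.re| ≤ 1 := abs_le.2 ⟨hre.1, by linarith [hre.2]⟩
    have hτ1 : 1 ≤ τ'.im := (le_max_right _ _).trans hτ
    have hGτ := hA₀ τ' ((le_max_left _ _).trans hτ)
    simp only [Set.mem_setOf_eq, div_one, Real.norm_eq_abs, abs_of_pos (Real.exp_pos _)] at hGτ
    have hnorm : ‖(τ' : ℂ)‖ ≤ 1 + τ'.im := by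
      refine (norm_le_abs_re_add_abs_im _).trans ?_
      rw [UpperHalfPlane.coe_re, UpperHalfPlane.coe_im, abs_of_pos τ'.im_pos]
      linarith
    calc ‖shiftRem F τ'‖ ≤ ‖F τ'‖ + ‖(τ' : ℂ) * shiftDiff F τ'‖ := norm_sub_le _ _
      _ = ‖F τ'‖ + ‖(τ' : ℂ)‖ * ‖shiftDiff F τ'‖ := by rw [norm_mul]
      _ ≤ α * τ'.im ^ (-β) + (1 + τ'.im) * (C * Real.exp (-2 * π * τ'.im)) :=
          add_le_add (hstrip τ' h1) (mul_le_mul hnorm hGτ (norm_nonneg _) (by positivity))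
      _ = α * τ'.im ^ (-β) + C * ((1 + τ'.im) * Real.exp (-2 * π * τ'.im)) := by ring
      _ ≤ α * τ'.im ^ (-β) + C * (1 / τ'.im) :=
          add_le_add le_rfl (mul_le_mul_of_nonneg_left (one_add_mul_exp_neg_two_pi_le hτ1) hC0)
  rw [IsZeroAtImInfty, ZeroAtFilter, Metric.tendsto_nhds]
  intro ε hε
  have ht : Tendsto (fun A : ℝ => α * A ^ (-β) + C * (1 / A)) atTop (𝓝 (α * 0 + C * 0)) :=
    ((tendsto_rpow_neg_atTop hβ).const_mul _).add ((tendsto_const_nhds.div_atTop tendsto_id).const_mul _)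
  rw [mul_zero, mul_zero, add_zero] at ht
  obtain ⟨A, hA⟩ := ((ht.eventually (gt_mem_nhds hε)).and (eventually_ge_atTop (max A₀ 1))).exists
  rw [Filter.Eventually, atImInfty_mem]
  refine ⟨A, fun τ hτ => ?_⟩
  simp only [Set.mem_setOf_eq, dist_zero_right]
  have hτ' : max A₀ 1 ≤ τ.im := hA.2.trans hτ
  have hApos : 0 < A := lt_of_lt_of_le one_pos ((le_max_right _ _).trans hA.2)
  calc ‖shiftRem F τ‖ ≤ α * τ.im ^ (-β) + C * (1 / τ.im) := hH τ hτ'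
    _ ≤ α * A ^ (-β) + C * (1 / A) := by
        refine add_le_add (mul_le_mul_of_nonneg_left ?_ hα) (mul_le_mul_of_nonneg_left ?_ hC0)
        · exact Real.rpow_le_rpow_of_nonpos hApos hτ (by linarith)
        · exact one_div_le_one_div_of_le hApos hτ
    _ < ε := hA.1

/-! ## The expansions -/

/-- **The expansion of `G`:** `G(τ) = ∑_{n ≥ 1} gₙ qⁿ`, `q = e^{2πiτ}`, with `gₙ` the `n`-th
`q`-expansion coefficient (CKMRV (3.4)). [cite: CohnEtAl2019, §3.1 (3.4)] -/
theorem hasSum_shiftDiff (hF : MDiff F)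
    (hFE : ∀ τ : ℍ, F ((2 : ℝ) +ᵥ τ) - 2 * F ((1 : ℝ) +ᵥ τ) + F τ = 0)
    {α β : ℝ} (hβ : 0 < β) (hstrip : ∀ τ : ℍ, |τ.re| ≤ 1 → ‖F τ‖ ≤ α * τ.im ^ (-β)) (τ : ℍ) :
    HasSum (fun n : ℕ => (qExpansion 1 (shiftDiff F)).coeff (n + 1) * Periodic.qParam 1 τ ^ (n + 1))
      (shiftDiff F τ) := by
  have hG0 := isZeroAtImInfty_shiftDiff hFE hβ hstrip
  have hper := periodic_shiftDiff hFE
  have hhol := mdifferentiable_shiftDiff hF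
  have h := hasSum_qExpansion one_pos hper hhol hG0.isBoundedAtImInfty τ
  simp only [smul_eq_mul] at h
  have h0 : (qExpansion 1 (shiftDiff F)).coeff 0 = 0 := by
    rw [qExpansion_coeff_zero one_pos (analyticAt_cuspFunction_zero one_pos hper hhol
      hG0.isBoundedAtImInfty) hper, hG0.valueAtInfty_eq_zero]
  rw [← hasSum_nat_add_iff' 1] at h
  simpa [h0] using h

/-- **The expansion of `H`:** `H(τ) = ∑_{n ≥ 1} aₙ qⁿ` (CKMRV (3.5)). [cite: CohnEtAl2019, §3.1 (3.5)] -/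
theorem hasSum_shiftRem (hF : MDiff F)
    (hFE : ∀ τ : ℍ, F ((2 : ℝ) +ᵥ τ) - 2 * F ((1 : ℝ) +ᵥ τ) + F τ = 0)
    {α β : ℝ} (hβ : 0 < β) (hstrip : ∀ τ : ℍ, |τ.re| ≤ 1 → ‖F τ‖ ≤ α * τ.im ^ (-β)) (τ : ℍ) :
    HasSum (fun n : ℕ => (qExpansion 1 (shiftRem F)).coeff (n + 1) * Periodic.qParam 1 τ ^ (n + 1))
      (shiftRem F τ) := by
  have hH0 := isZeroAtImInfty_shiftRem hF hFE hβ hstrip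
  have hper := periodic_shiftRem hFE
  have hhol := mdifferentiable_shiftRem hF
  have h := hasSum_qExpansion one_pos hper hhol hH0.isBoundedAtImInfty τ
  simp only [smul_eq_mul] at h
  have h0 : (qExpansion 1 (shiftRem F)).coeff 0 = 0 := by
    rw [qExpansion_coeff_zero one_pos (analyticAt_cuspFunction_zero one_pos hper hhol
      hH0.isBoundedAtImInfty) hper, hH0.valueAtInfty_eq_zero]
  rw [← hasSum_nat_add_iff' 1] at h
  simpa [h0] using h

/-- **CKMRV (3.3):** `F(τ) = ∑_{n≥1} aₙ qⁿ + τ ∑_{n≥1} gₙ qⁿ` — the functional equation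
`F(τ+2) − 2F(τ+1) + F(τ) = 0` together with holomorphy and decay on the strip force an expansion
"periodic plus `τ` times periodic" without constant terms. [cite: CohnEtAl2019, §3.1 (3.3)] -/
theorem eq_tsum_add_mul_tsum (hF : MDiff F)
    (hFE : ∀ τ : ℍ, F ((2 : ℝ) +ᵥ τ) - 2 * F ((1 : ℝ) +ᵥ τ) + F τ = 0)
    {α β : ℝ} (hβ : 0 < β) (hstrip : ∀ τ : ℍ, |τ.re| ≤ 1 → ‖F τ‖ ≤ α * τ.im ^ (-β)) (τ : ℍ) :
    F τ = (∑' n : ℕ, (qExpansion 1 (shiftRem F)).coeff (n + 1) * Periodic.qParam 1 τ ^ (n + 1)) +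
      (τ : ℂ) * ∑' n : ℕ, (qExpansion 1 (shiftDiff F)).coeff (n + 1) * Periodic.qParam 1 τ ^ (n + 1) := by
  rw [(hasSum_shiftRem hF hFE hβ hstrip τ).tsum_eq, (hasSum_shiftDiff hF hFE hβ hstrip τ).tsum_eq]
  exact eq_shiftRem_add F τ

/-! ## Coefficient bounds: polynomial growth -/

/-- **Bound for `q`-expansion coefficients from a horizontal segment:** for a `1`-periodic
holomorphic `f : ℍ → ℂ` bounded at `i∞`, `‖coeff_n(f)‖ ≤ e^{2πnt} M` whenever `‖f(u + it)‖ ≤ M`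
for `u ∈ [0, 1]` (`t > 0`; Mathlib's `qExpansion_coeff_eq_intervalIntegral`). [folklore] -/
theorem norm_qExpansion_coeff_le {f : ℍ → ℂ} (hper : Periodic (f ∘ ofComplex) 1) (hhol : MDiff f)
    (hbdd : IsBoundedAtImInfty f) (n : ℕ) {t : ℝ} (ht : 0 < t) {M : ℝ}
    (hM : ∀ τ : ℍ, τ.im = t → 0 ≤ τ.re → τ.re ≤ 1 → ‖f τ‖ ≤ M) :
    ‖(qExpansion 1 f).coeff n‖ ≤ Real.exp (2 * π * n * t) * M := by
  rw [qExpansion_coeff_eq_intervalIntegral one_pos hper hhol hbdd n ht]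
  simp only [Complex.ofReal_one, div_one, one_mul, UpperHalfPlane.coe_I]
  have hM0 : 0 ≤ M := by
    have h := hM ⟨t * Complex.I, by simpa using ht⟩ (by simp [UpperHalfPlane.im])
      (by simp [UpperHalfPlane.re]) (by simp [UpperHalfPlane.re])
    exact le_trans (norm_nonneg _) h
  have h := intervalIntegral.norm_integral_le_of_norm_le_const (a := (0 : ℝ)) (b := 1)
    (C := Real.exp (2 * π * n * t) * M)
    (f := fun u : ℝ => 1 / Periodic.qParam 1 (u + t * Complex.I) ^ n * f ⟨u + t * Complex.I, by simpa using ht⟩) ?_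
  · simpa using h
  · intro u hu
    rw [Set.uIoc_of_le zero_le_one] at hu
    rw [norm_mul, norm_div, norm_one, norm_pow, Periodic.norm_qParam]
    have hq : Real.exp (-2 * π * (u + t * Complex.I).im / 1) = Real.exp (-2 * π * t) := by
      congr 1; simp
    rw [hq, ← Real.exp_nat_mul, one_div, ← Real.exp_neg]
    refine mul_le_mul (le_of_eq ?_) (hM _ (by simp [UpperHalfPlane.im]) (by simpa [UpperHalfPlane.re] using hu.1.le)
      (by simpa [UpperHalfPlane.re] using hu.2)) (norm_nonneg _) (by positivity)
    congr 1; ring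

/-- **Polynomial growth of the coefficients** (CKMRV: "if we take `y = 1/n` … these … grow at most
polynomially in `n`"): for a `1`-periodic holomorphic `f` with `‖f τ‖ ≤ α Im(τ)^{−β}` for
`0 ≤ Re τ ≤ 1`, `Im τ ≤ 1` (`α, β ≥ 0`), `‖coeff_n(f)‖ ≤ e^{2π} α nᵝ` for `n ≥ 1`. [cite: CohnEtAl2019, §3.1 (proof of Theorem 3.1)] -/
theorem norm_qExpansion_coeff_le_of_strip {f : ℍ → ℂ} (hper : Periodic (f ∘ ofComplex) 1)
    (hhol : MDiff f) (hbdd : IsBoundedAtImInfty f) {α β : ℝ}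
    (hstrip : ∀ τ : ℍ, 0 ≤ τ.re → τ.re ≤ 1 → τ.im ≤ 1 → ‖f τ‖ ≤ α * τ.im ^ (-β))
    {n : ℕ} (hn : 1 ≤ n) :
    ‖(qExpansion 1 f).coeff n‖ ≤ Real.exp (2 * π) * α * (n : ℝ) ^ β := by
  have hn0 : (0 : ℝ) < n := by exact_mod_cast hn
  have ht : (0 : ℝ) < 1 / n := by positivity
  have h := norm_qExpansion_coeff_le hper hhol hbdd n ht (M := α * (n : ℝ) ^ β) ?_
  · refine h.trans (le_of_eq ?_)
    rw [show 2 * π * n * (1 / n : ℝ) = 2 * π by field_simp]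
    ring
  · intro τ him hre0 hre1
    refine (hstrip τ hre0 hre1 (by rw [him, div_le_one hn0]; exact_mod_cast hn)).trans (le_of_eq ?_)
    rw [him, one_div, Real.rpow_neg (inv_nonneg.2 hn0.le), Real.inv_rpow hn0.le, inv_inv]

end Literature.Analysis.Fourier
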